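import Summits.QuantumFields.BalabanUV.Beta.FP.PerfectPolarizationWardLetters
import Summits.QuantumFields.BalabanUV.Beta.FP.SliceVertex
import Summits.QuantumFields.BalabanUV.Beta.FP.PuncturedCoordDeriv
import Summits.QuantumFields.BalabanUV.Beta.FP.SliceVertexReflection

/-!
# `BalabanUV.Beta.FP.SliceGaugeLaw` — road «FP» for binder row D1, sub-row H2-ASM-5a «layer b», GLUON sector (a4): THE SLICE HALF OF THE GAUGE-COMMUTATOR
# LAW, PROVED FOR THE ROAD's EXPLICIT BF-SLICE FAMILY `SliceVertex.sliceA 3` AGAINST THE EXPLICIT `ξ = 1` SLICE HESSIAN `dd*` — `divV (sliceA 3) y = 1 • (dd* ∘ Π_y − Π_y ∘ dd*)`,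
# the explicit kernel `K[sliceSym γ β](w) = [w = e_β − e_γ] − [w = −e_γ] − [w = e_β] + [w = 0]`, and the LOCATED fibre-convention fork L-gan24leaf02-g41-1 (a kernel `¬`)

HONEST DEPENDENCY (page 1, mandatory): continuum YM on T⁴ ⇐ BetaPertH ∧ nine spine estimates (0/9 proved); BetaPertH ⇐ (D1) ∧ (D4) ∧ CAP+tail;
G-an2-4 gates asym, D1 and NE2/3/4.  HONEST FRAMING (cell contract, verbatim): «discharging `BetaPertH` makes Bałaban's UV stability UNCONDITIONAL —
a real constructive-QFT result; it is NOT the continuum limit and NOT the Clay problem.»  THIS MODULE DISCHARGES NOTHING of the wall: explicit finite stencil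
algebra on `ℤ⁴` and two lattice-Fourier phase shifts ([our object] identities about this lineage's `sliceA` (H2V-2, g38), `sliceSym`∕`MF` (H2-P-INVKER, g40) and
`proj` (layer b, g40)); ONE data def (`ddKer`), no `def … : Prop`, nothing cited, 0 sorry; 0∕4 row-D1 binders; NOT (a4-total) (the perfect action's cubic jet `S∞³` is
H2V-4′'s S-side — not typed here), NOT (a8), NOT (K0), NOT D1, NOT BetaPertH, NOT continuum, NOT Clay.  «not in print; our bookkeeping».

ABSOLUTE RULE (cell charter, verbatim): «No internally-minted statement may enter as a cited fact. Every hypothesis is either kernel-proved in this package or a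
verbatim quotation of a PUBLISHED theorem with page reference. The manuscript(s) under audit are NOT citable for their own disputed steps — they are the thing
under adjudication; programme-internal (2001/route/tribunal) claims are never citable.»

CONTENT (lattice `ℤ^{d+1}` in §1; `ℤ⁴`, packed fibre `Fib 3 = Fin 4 ⊕ Fin 4` from §2 on).
* §1 [folklore] `latticeKernel_cexp_neg_mul` (the conjugate phase `e^{−ip_j}` shifts the kernel by `−e_j`), `latticeKernel_expFacNeg` (`K[e^{−ip_β} − 1](v) = [v = e_β] − [v = 0]`),
  **`latticeKernel_sliceSym`**: `K[sliceSym γ β](w) = [w = e_β − e_γ] − [w = −e_γ] − [w = e_β] + [w = 0]` (`sliceSym γ β = (e^{ip_γ} − 1)(e^{−ip_β} − 1)` = the symbol of `dd*` on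
  1-forms for `v̂(p) = Σ_x v(x)e^{−ip·x}`; `latticeKernel_fwdDiff` + the backward phase), solved forms `latticeKernel_sliceSym_col` ∕ `_row` at `w = z − x`.
* §2 [our object] **`ddKer : MKer 4 (Fib 3)`** := the `ξ = 1` slice Hessian `dd*` in the STRAIGHT row∕column reading of `SliceVertex.sEntry`∕`sliceA` and an3's `wilsonA`
  (row `(x, α)`, column `(z, β)` ↦ `Re K[sliceSym β α](z − x)`; zero off the field block); `ddKer_apply` (`= [z = x+e_α−e_β] − [z = x−e_β] − [z = x+e_α] + [z = x]` =
  `∂_{v_β(z)}(dd*v)_α(x)`, `(d*v)(y) = Σ_β (v_β(y−e_β) − v_β(y))`), `ddKer_apply_row`; DICTIONARY **`MF_inl_inl_eq_deltaZLim_add_ddKer : MF x z (inl γ) (inl β) =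
  deltaZLim (z,γ) (x,β) + ddKer x z (inl β) (inl γ)`** — `MF`'s slice block (`PerfectPropagatorInverse.MF_inl_inl_eq_deltaZLim` ✓) IS THE FIBRE-TRANSPOSE of `ddKer` (g40's
  located note N-gan24leaf02-g40-1 as a lemma); `ddKer_transpose`; JUNCTION **`ddKer_inl_inl_eq_dz_codiff₁`**: the same entries ARE `AffineAveraging`'s bond matrix
  `(d δ δ_{(β,z)})_α(x)` of the D1 swarm's `SliceVertexReflection` (p251422 ✓) — the Fourier and the difference-operator derivations of `dd*` agree by name.
* §3 [our object] `sEntry_apply_mul` (product form with the direction indicator `[α = κ′]` split off), the four collapsed bond sums `sum_sEntry_*`, and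
  **`divV_sliceA_inl_inl`**: `(divV (sliceA 3) y) x z (inl α) (inl β) = [x=y]·([z=y−e_β] + [z=y+e_α] − [z=y+e_α−e_β]) − [z=y]·([x=y−e_α] + [x=y+e_β] − [x=y+e_β−e_α])`
  (written as a polynomial in the indicator atoms), `divV_sliceA_inl_inr` ∕ `_inr_inl` ∕ `_inr_inr` (all other blocks `0`).
* §4 [our object] **THE SLICE GAUGE LAW `divV_sliceA : divV (sliceA 3) y = (1 : ℝ) • (comp ddKer (proj y) − comp (proj y) ddKer)`** — the lattice divergence (in the background
  bond at `y`) of the antisymmetrised BF-slice first jet IS the commutator of the slice Hessian with the site projection `Π_y = projM fmask y` (infinitesimal BACKGROUND-gauge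
  covariance of `½|D*_B W|²` at `B = 𝟙`, colour-stripped), constant `c_s = +1` (the sign of `GhostGaugeLaw.divV_ghCur`'s `cg = 1` against `−Δ`); proof = `ring` over the
  indicator atoms after `comp_projM`∕`projM_comp`, no case analysis on sites.
* §5 [our object] `divV_sliceA_fibreTranspose` — the fibre-transposed family `(κ,u,x,z,a,b) ↦ sliceA 3 κ u x z b a` obeys the SAME law (`c = 1`) against `MF`'s slice block (§2).
* §6 [our object] **LOCATED L-gan24leaf02-g41-1 as a kernel `¬`: `not_divV_sliceA_against_MF_slice`** — against `MF`'s OWN (crosswise) slice block NO constant works for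
  the straight family: `∀ c, divV (sliceA 3) 0 ≠ c • (comp ddKerᶠ (proj 0) − comp (proj 0) ddKerᶠ)` (witness entry `(0, inl 0 ; e_0, inl 1)`: `1 ≠ c·0`).
WHAT THIS SAYS TO THE ROAD (located, NOT a choice made here).  W2's letter (a4-total) `divV V y = c • (comp MF (proj y) − comp (proj y) MF)` (`PerfectPolarizationWardLetters` §6)
is filled — on the slice summand — by vertex families typed IN `MF`'s FIBRE CONVENTION (§5), NOT by the H2V-2 family `sliceA 3` as typed in `wilsonA`'s straight convention
(§6).  Which side transposes (`V ↦ Vᶠ` in `PiBF`, or `MF`∕`Pker` re-read straight) is the road-FP OWNER's convention decision (N-d1leaf02g9-1 «owner decision with H2V-4»);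
this file asserts neither branch.  The invariant half (`divV S∞³ y` against `Δ_∞`) is H2V-4′'s and is not touched.
Provenance: G-an2-4 formalisation swarm seat b2b-balaban-gan24-formalise-leaf-02 gen 41 (cross-lane on road FP; continuation of g38's H2V-2 and g40's layer b), 2026-08-21.
-/

noncomputable section

namespace Summit.QuantumFields.BalabanUV.Beta.FP.SliceGaugeLaw

open MeasureTheory Complex Finset
open scoped Real BigOperators
open Literature.MathematicalPhysics.QuantumFieldTheory.Balaban1983to89
open Literature.MathematicalPhysics.QuantumFieldTheory.Balaban1983to89.Beta
open B4ContourShift (BZ integrand latticeKernel StripRegular stripRegular_const)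
open B5Symbol166Strip (expFacNeg expFacPos stripRegular_expFacNeg stripRegular_expFacPos)
open B6BondElimination (unitVec unitVec_apply)
open ExpKernelCalculus (MKer Site comp)
open OneStepResolventKernel (Fib)
open KernelWard (divV)
open Literature.MathematicalPhysics.QuantumFieldTheory.Balaban1983to89.Beta.FibreInverseDecay (latticeKernel_const)
open Summit.QuantumFields.BalabanUV.Beta.GAN24.EffectiveLaplacianLimit (deltaZLim)
open Summit.QuantumFields.BalabanUV.Beta.FP.PerfectMaxwellDict (latticeKernel_sub)
open Summit.QuantumFields.BalabanUV.Beta.FP.PuncturedCoordDeriv (latticeKernel_cexp_mul latticeKernel_fwdDiff)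
open Summit.QuantumFields.BalabanUV.Beta.FP.PerfectFeynmanSymbol (sliceSym)
open Summit.QuantumFields.BalabanUV.Beta.FP.PerfectPropagatorInverse (MF MF_inl_inl_eq_deltaZLim)
open Summit.QuantumFields.BalabanUV.Beta.FP.WardSandwichEngine (projM projM_apply comp_projM projM_comp)
open Summit.QuantumFields.BalabanUV.Beta.FP.PerfectPolarizationWardLetters (fmask fmask_inl fmask_inr proj proj_def)
open Summit.QuantumFields.BalabanUV.Beta.FP.SliceVertex (sEntry sEntry_apply sliceA sliceA_inl_inl sliceA_antisymm)

/-! ## §1 [folklore] The explicit kernel of the slice symbol `sliceSym γ β = (e^{ip_γ} − 1)(e^{−ip_β} − 1)` -/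

section Kernel

variable {d : ℕ}

/-- [folklore] `unitVec j = Pi.single j 1` (the two spellings of the unit lattice vector). -/
theorem unitVec_eq_single (j : Fin (d + 1)) : (unitVec j : Fin (d + 1) → ℤ) = Pi.single j 1 := by
  funext i
  simp [unitVec, Pi.single_apply]

/-- [folklore] MULTIPLYING THE SYMBOL BY THE CONJUGATE COORDINATE PHASE `e^{−ip_j}` SHIFTS THE KERNEL BY `−e_j`:
`latticeKernel (e^{−ip_j}·G) x = latticeKernel G (x − e_j)` (from `PuncturedCoordDeriv.latticeKernel_cexp_mul` at `x − e_j`; no integrability needed). -/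
theorem latticeKernel_cexp_neg_mul (G : (Fin (d + 1) → ℂ) → ℂ) (j : Fin (d + 1)) (x : Fin (d + 1) → ℤ) :
    latticeKernel (fun p => cexp (-(p j * I)) * G p) x = latticeKernel G (x - unitVec j) := by
  have h := latticeKernel_cexp_mul (fun p => cexp (-(p j * I)) * G p) j (x - Pi.single j 1)
  rw [sub_add_cancel] at h
  rw [unitVec_eq_single, ← h]
  congr 1
  funext p
  rw [← mul_assoc, ← Complex.exp_add, show I * p j + -(p j * I) = 0 by ring, Complex.exp_zero, one_mul]

/-- [folklore] THE KERNEL OF `expFacNeg β = e^{−ip_β} − 1`: `[v = e_β] − [v = 0]`. -/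
theorem latticeKernel_expFacNeg (β : Fin (d + 1)) (v : Fin (d + 1) → ℤ) :
    latticeKernel (fun p => expFacNeg β p) v = (if v = unitVec β then 1 else 0) - (if v = 0 then 1 else 0) := by
  have e : (fun p : Fin (d + 1) → ℂ => expFacNeg β p) = fun p => (fun q : Fin (d + 1) → ℂ => cexp (-(q β * I)) * (1 : ℂ)) p - (fun _ : Fin (d + 1) → ℂ => (1 : ℂ)) p := by
    funext p; unfold expFacNeg; ring
  have e1 : (fun q : Fin (d + 1) → ℂ => cexp (-(q β * I)) * (1 : ℂ)) = fun p => expFacNeg β p + 1 := by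
    funext p; unfold expFacNeg; ring
  have h1 : IntegrableOn (integrand (fun q : Fin (d + 1) → ℂ => cexp (-(q β * I)) * (1 : ℂ)) v) (BZ (d + 1)) := by
    rw [e1]
    exact ((stripRegular_expFacNeg β 0).add (stripRegular_const 1 0)).integrableOn le_rfl v
  have h2 : IntegrableOn (integrand (fun _ : Fin (d + 1) → ℂ => (1 : ℂ)) v) (BZ (d + 1)) := (stripRegular_const 1 0).integrableOn le_rfl v
  rw [e, latticeKernel_sub h1 h2, latticeKernel_cexp_neg_mul, latticeKernel_const, latticeKernel_const]
  rcases eq_or_ne v (unitVec β) with h | h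
  · rw [if_pos (sub_eq_zero.mpr h), if_pos h]
  · rw [if_neg (fun e => h (sub_eq_zero.mp e)), if_neg h]

/-- [folklore] **THE EXPLICIT SLICE KERNEL**: `K[sliceSym γ β](w) = [w = e_β − e_γ] − [w = −e_γ] − [w = e_β] + [w = 0]` — four unit masses: the `(γ, β)` entry of the
lattice operator `dd*` on 1-forms read at separation `w` (see §2 for which way round). -/
theorem latticeKernel_sliceSym (γ β : Fin (d + 1)) (w : Fin (d + 1) → ℤ) :
    latticeKernel (sliceSym γ β) w = (if w + unitVec γ = unitVec β then 1 else 0) - (if w + unitVec γ = 0 then 1 else 0)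
      - ((if w = unitVec β then 1 else 0) - (if w = 0 then 1 else 0)) := by
  have e : (sliceSym (d := d) γ β) = fun p => (cexp (I * p γ) - 1) * (fun q : Fin (d + 1) → ℂ => expFacNeg β q) p := by
    funext p; unfold sliceSym expFacPos; rw [mul_comm (p γ) I]
  have hint : ∀ v, IntegrableOn (integrand (fun q : Fin (d + 1) → ℂ => expFacNeg β q) v) (BZ (d + 1)) :=
    fun v => (stripRegular_expFacNeg β 0).integrableOn le_rfl v
  rw [e, latticeKernel_fwdDiff _ γ w (hint w) (hint _), ← unitVec_eq_single, latticeKernel_expFacNeg, latticeKernel_expFacNeg]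

/-- [folklore] the slice kernel at `w = z − x`, conditions SOLVED FOR THE COLUMN SITE `z`:
`K[sliceSym γ β](z − x) = [z = x + e_β − e_γ] − [z = x − e_γ] − [z = x + e_β] + [z = x]`. -/
theorem latticeKernel_sliceSym_col (γ β : Fin (d + 1)) (x z : Fin (d + 1) → ℤ) :
    latticeKernel (sliceSym γ β) (z - x) = (if z = x + unitVec β - unitVec γ then 1 else 0) - (if z = x - unitVec γ then 1 else 0)
      - (if z = x + unitVec β then 1 else 0) + (if z = x then 1 else 0) := by
  rw [latticeKernel_sliceSym]
  have i1 : (z - x + unitVec γ = unitVec β) ↔ (z = x + unitVec β - unitVec γ) :=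
    ⟨fun h => by rw [← h]; abel, fun h => by rw [h]; abel⟩
  have i2 : (z - x + unitVec γ = 0) ↔ (z = x - unitVec γ) :=
    ⟨fun h => by rw [← sub_eq_zero, ← h]; abel, fun h => by rw [h]; abel⟩
  have i3 : (z - x = unitVec β) ↔ (z = x + unitVec β) :=
    ⟨fun h => by rw [← h]; abel, fun h => by rw [h]; abel⟩
  have i4 : (z - x = 0) ↔ (z = x) := sub_eq_zero
  rw [if_congr i1 rfl rfl, if_congr i2 rfl rfl, if_congr i3 rfl rfl, if_congr i4 rfl rfl]
  ring

/-- [folklore] the slice kernel at `w = z − x`, conditions SOLVED FOR THE ROW SITE `x`: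
`K[sliceSym γ β](z − x) = [x = z + e_γ − e_β] − [x = z + e_γ] − [x = z − e_β] + [x = z]`. -/
theorem latticeKernel_sliceSym_row (γ β : Fin (d + 1)) (x z : Fin (d + 1) → ℤ) :
    latticeKernel (sliceSym γ β) (z - x) = (if x = z + unitVec γ - unitVec β then 1 else 0) - (if x = z + unitVec γ then 1 else 0)
      - (if x = z - unitVec β then 1 else 0) + (if x = z then 1 else 0) := by
  rw [latticeKernel_sliceSym]
  have i1 : (z - x + unitVec γ = unitVec β) ↔ (x = z + unitVec γ - unitVec β) :=
    ⟨fun h => by rw [← h]; abel, fun h => by rw [h]; abel⟩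
  have i2 : (z - x + unitVec γ = 0) ↔ (x = z + unitVec γ) :=
    ⟨fun h => by rw [eq_comm, ← sub_eq_zero, ← h]; abel, fun h => by rw [h]; abel⟩
  have i3 : (z - x = unitVec β) ↔ (x = z - unitVec β) :=
    ⟨fun h => by rw [← h]; abel, fun h => by rw [h]; abel⟩
  have i4 : (z - x = 0) ↔ (x = z) := sub_eq_zero.trans eq_comm
  rw [if_congr i1 rfl rfl, if_congr i2 rfl rfl, if_congr i3 rfl rfl, if_congr i4 rfl rfl]
  ring

end Kernel

/-! ## §2 [our object] The straight slice Hessian `ddKer` and the dictionary with `MF`'s slice block -/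

section DdKer

/-- [our object] **THE `ξ = 1` SLICE HESSIAN `dd*` ON THE PACKED FIBRE, STRAIGHT READING**: field block row `(x, α)`, column `(z, β)` ↦ `Re K[sliceSym β α](z − x)`
(`= ∂_{v_β(z)} (dd* v)_α(x)`, see `ddKer_apply`), every block touching a multiplier leg `0` — the row∕column convention of `SliceVertex.sEntry`∕`sliceA` and of an3's
`wilsonA` (matrix entries of a Hessian vertex), NOT the crosswise convention of `PerfectPropagatorInverse.MF` (whose slice block is `Re K[sliceSym α β](z − x)`,
`MF_inl_inl_eq_deltaZLim_add_ddKer`).  A definition asserting nothing. -/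
def ddKer : MKer 4 (Fib 3) := fun x z a b =>
  match a, b with
  | Sum.inl α, Sum.inl β => (latticeKernel (sliceSym (d := 3) β α) (z - x)).re
  | Sum.inl _, Sum.inr _ => 0
  | Sum.inr _, Sum.inl _ => 0
  | Sum.inr _, Sum.inr _ => 0

/-- [our object] the field block of `ddKer` (definitional). -/
theorem ddKer_inl_inl (x z : Site 4) (α β : Fin 4) : ddKer x z (Sum.inl α) (Sum.inl β) = (latticeKernel (sliceSym (d := 3) β α) (z - x)).re := rfl

/-- [our object] the field–multiplier block of `ddKer` vanishes. -/
@[simp] theorem ddKer_inl_inr (x z : Site 4) (α j : Fin 4) : ddKer x z (Sum.inl α) (Sum.inr j) = 0 := rfl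

/-- [our object] the multiplier–field block of `ddKer` vanishes. -/
@[simp] theorem ddKer_inr_inl (x z : Site 4) (i β : Fin 4) : ddKer x z (Sum.inr i) (Sum.inl β) = 0 := rfl

/-- [our object] the multiplier block of `ddKer` vanishes. -/
@[simp] theorem ddKer_inr_inr (x z : Site 4) (i j : Fin 4) : ddKer x z (Sum.inr i) (Sum.inr j) = 0 := rfl

/-- [folklore] the real part of a complex unit indicator. -/
theorem re_ite_one (P : Prop) [Decidable P] : (if P then (1 : ℂ) else 0).re = if P then (1 : ℝ) else 0 := by
  split_ifs <;> simp

/-- [our object] **CLOSED FORM, COLUMN-SOLVED**: `ddKer x z (inl α) (inl β) = [z = x + e_α − e_β] − [z = x − e_β] − [z = x + e_α] + [z = x]` — the kernel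
`∂_{v_β(z)} (dd* v)_α(x)` of `dd*` with `(d*v)(y) = Σ_β (v_β(y − e_β) − v_β(y))`, `(dλ)_α(x) = λ(x + e_α) − λ(x)`. -/
theorem ddKer_apply (x z : Site 4) (α β : Fin 4) : ddKer x z (Sum.inl α) (Sum.inl β)
    = (if z = x + unitVec α - unitVec β then 1 else 0) - (if z = x - unitVec β then 1 else 0)
      - (if z = x + unitVec α then 1 else 0) + (if z = x then 1 else 0) := by
  rw [ddKer_inl_inl, latticeKernel_sliceSym_col]
  simp only [Complex.sub_re, Complex.add_re, re_ite_one]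

/-- [our object] **CLOSED FORM, ROW-SOLVED**: `ddKer x z (inl α) (inl β) = [x = z + e_β − e_α] − [x = z + e_β] − [x = z − e_α] + [x = z]`. -/
theorem ddKer_apply_row (x z : Site 4) (α β : Fin 4) : ddKer x z (Sum.inl α) (Sum.inl β)
    = (if x = z + unitVec β - unitVec α then 1 else 0) - (if x = z + unitVec β then 1 else 0)
      - (if x = z - unitVec α then 1 else 0) + (if x = z then 1 else 0) := by
  rw [ddKer_inl_inl, latticeKernel_sliceSym_row]
  simp only [Complex.sub_re, Complex.add_re, re_ite_one]

/-- [our object] **DICTIONARY: `MF`'s SLICE BLOCK IS THE FIBRE-TRANSPOSE OF `ddKer`** — `MF x z (inl γ) (inl β) = deltaZLim (z, γ) (x, β) + ddKer x z (inl β) (inl γ)`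
(`PerfectPropagatorInverse.MF_inl_inl_eq_deltaZLim` ✓ + the definition; g40's located note N-gan24leaf02-g40-1 «direction indices enter crosswise»). -/
theorem MF_inl_inl_eq_deltaZLim_add_ddKer (x z : Site 4) (γ β : Fin 4) :
    MF x z (Sum.inl γ) (Sum.inl β) = deltaZLim (d := 3) (z, γ) (x, β) + ddKer x z (Sum.inl β) (Sum.inl γ) := by
  rw [MF_inl_inl_eq_deltaZLim, ddKer_inl_inl]

/-- [our object] `ddKer` is symmetric under the FULL transpose (sites and fibre indices exchanged together) — it is a Hessian. -/
theorem ddKer_transpose (x z : Site 4) (a b : Fib 3) : ddKer z x b a = ddKer x z a b := by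
  rcases a with α | i <;> rcases b with β | j
  · rw [ddKer_apply_row, ddKer_apply]
    ring
  all_goals rfl

/-- [our object] **JUNCTION WITH THE D1 SWARM's REFLECTION FILE (two derivations, one object)**: the field block of `ddKer` — obtained here from the FOURIER symbol
`sliceSym` — IS `AffineAveraging`'s difference-operator bond matrix `(d δ δ_{(β,z)})_α(x)` of `SliceVertexReflection.dz_codiff₁_delta1_apply` (beta-d1-formalise-leaf-02-g10,
p251422 ✓), entry by entry. -/
theorem ddKer_inl_inl_eq_dz_codiff₁ (x z : Site 4) (α β : Fin 4) :
    ddKer x z (Sum.inl α) (Sum.inl β) = AffineAveraging.dz (AffineAveraging.codiff₁ (KKTFluctuationKernel.delta1 β z)) α x := by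
  rw [ddKer_apply, SliceVertexReflection.dz_codiff₁_delta1_apply]
  simp only [WilsonReflectionContact.unitVec_eq]
  have i1 : (x + unitVec α - unitVec β = z) ↔ (z = x + unitVec α - unitVec β) := eq_comm
  have i2 : (x + unitVec α = z) ↔ (z = x + unitVec α) := eq_comm
  have i3 : (x - unitVec β = z) ↔ (z = x - unitVec β) := eq_comm
  have i4 : (x = z) ↔ (z = x) := eq_comm
  rw [if_congr i1 rfl rfl, if_congr i2 rfl rfl, if_congr i3 rfl rfl, if_congr i4 rfl rfl]
  ring

end DdKer

/-! ## §3 [our object] The divergence of the slice family, entrywise -/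

section Divergence

/-- [folklore] the entry of a bond divergence `divV V y` is the bond sum of the entries. -/
theorem divV_apply (V : Fin 4 → Site 4 → MKer 4 (Fib 3)) (y x z : Site 4) (a b : Fib 3) :
    divV V y x z a b = ∑ μ : Fin 4, (V μ (y - unitVec μ) x z a b - V μ y x z a b) := by
  unfold divV
  simp only [Finset.sum_apply, Pi.sub_apply]

/-- [our object] `sEntry` IN PRODUCT FORM with the direction indicator split off:
`sEntry 3 κ′ u x z α β = −2·[α = κ′]·[x = u]·([z = u + e_{κ′}] − [z = u + e_{κ′} − e_β])`. -/
theorem sEntry_apply_mul (κ' : Fin 4) (u x z : Site 4) (α β : Fin 4) : sEntry 3 κ' u x z α β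
    = -2 * ((if α = κ' then (1 : ℝ) else 0) * ((if x = u then (1 : ℝ) else 0)
        * ((if z = u + unitVec κ' then (1 : ℝ) else 0) - (if z = u + unitVec κ' - unitVec β then (1 : ℝ) else 0)))) := by
  rw [sEntry_apply]
  by_cases hα : α = κ'
  · by_cases hx : x = u
    · simp [hα, hx]
    · simp [hα, hx]
  · simp [hα]

/-- [folklore] a bond sum against the direction indicator collapses: `Σ_μ [α = μ]·f μ = f α`. -/
theorem sum_ite_eq_mul (α : Fin 4) (f : Fin 4 → ℝ) : ∑ μ : Fin 4, (if α = μ then (1 : ℝ) else 0) * f μ = f α := by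
  simp only [boole_mul, Finset.sum_ite_eq, Finset.mem_univ, if_true]

/-- [our object] FIRST BOND SUM (shifted bonds, straight entry): `Σ_μ sEntry 3 μ (y − e_μ) x z α β = −2·[x = y − e_α]·([z = y] − [z = y − e_β])`. -/
theorem sum_sEntry_shift (y x z : Site 4) (α β : Fin 4) : ∑ μ : Fin 4, sEntry 3 μ (y - unitVec μ) x z α β
    = -2 * ((if x = y - unitVec α then (1 : ℝ) else 0) * ((if z = y then (1 : ℝ) else 0) - (if z = y - unitVec β then (1 : ℝ) else 0))) := by
  simp only [sEntry_apply_mul, sub_add_cancel, ← Finset.mul_sum]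
  rw [sum_ite_eq_mul]

/-- [our object] SECOND BOND SUM (shifted bonds, transposed entry): `Σ_μ sEntry 3 μ (y − e_μ) z x β α = −2·[z = y − e_β]·([x = y] − [x = y − e_α])`. -/
theorem sum_sEntry_shift' (y x z : Site 4) (α β : Fin 4) : ∑ μ : Fin 4, sEntry 3 μ (y - unitVec μ) z x β α
    = -2 * ((if z = y - unitVec β then (1 : ℝ) else 0) * ((if x = y then (1 : ℝ) else 0) - (if x = y - unitVec α then (1 : ℝ) else 0))) := by
  simp only [sEntry_apply_mul, sub_add_cancel, ← Finset.mul_sum]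
  rw [sum_ite_eq_mul]

/-- [our object] THIRD BOND SUM (bonds at `y`, straight entry): `Σ_μ sEntry 3 μ y x z α β = −2·[x = y]·([z = y + e_α] − [z = y + e_α − e_β])`. -/
theorem sum_sEntry_base (y x z : Site 4) (α β : Fin 4) : ∑ μ : Fin 4, sEntry 3 μ y x z α β
    = -2 * ((if x = y then (1 : ℝ) else 0) * ((if z = y + unitVec α then (1 : ℝ) else 0) - (if z = y + unitVec α - unitVec β then (1 : ℝ) else 0))) := by
  simp only [sEntry_apply_mul, ← Finset.mul_sum]
  rw [sum_ite_eq_mul]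

/-- [our object] FOURTH BOND SUM (bonds at `y`, transposed entry): `Σ_μ sEntry 3 μ y z x β α = −2·[z = y]·([x = y + e_β] − [x = y + e_β − e_α])`. -/
theorem sum_sEntry_base' (y x z : Site 4) (α β : Fin 4) : ∑ μ : Fin 4, sEntry 3 μ y z x β α
    = -2 * ((if z = y then (1 : ℝ) else 0) * ((if x = y + unitVec β then (1 : ℝ) else 0) - (if x = y + unitVec β - unitVec α then (1 : ℝ) else 0))) := by
  simp only [sEntry_apply_mul, ← Finset.mul_sum]
  rw [sum_ite_eq_mul]

/-- [our object] **THE DIVERGENCE OF THE SLICE FAMILY ON THE FIELD BLOCK**, as a polynomial in the indicator atoms: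
`(divV (sliceA 3) y) x z (inl α) (inl β) = [x=y]·([z=y−e_β] + [z=y+e_α] − [z=y+e_α−e_β]) − [z=y]·([x=y−e_α] + [x=y+e_β] − [x=y+e_β−e_α])`
(the two `[x = y − e_α]·[z = y − e_β]` products of the raw expansion cancel). -/
theorem divV_sliceA_inl_inl (y x z : Site 4) (α β : Fin 4) : divV (sliceA 3) y x z (Sum.inl α) (Sum.inl β)
    = (if x = y then (1 : ℝ) else 0) * ((if z = y - unitVec β then (1 : ℝ) else 0) + (if z = y + unitVec α then (1 : ℝ) else 0)
          - (if z = y + unitVec α - unitVec β then (1 : ℝ) else 0))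
      - (if z = y then (1 : ℝ) else 0) * ((if x = y - unitVec α then (1 : ℝ) else 0) + (if x = y + unitVec β then (1 : ℝ) else 0)
          - (if x = y + unitVec β - unitVec α then (1 : ℝ) else 0)) := by
  rw [divV_apply]
  simp only [sliceA_inl_inl, Finset.sum_sub_distrib, ← Finset.mul_sum]
  rw [sum_sEntry_shift, sum_sEntry_shift', sum_sEntry_base, sum_sEntry_base']
  ring

/-- [our object] the divergence of the slice family vanishes on every block touching a multiplier leg. -/
theorem divV_sliceA_inl_inr (y x z : Site 4) (α j : Fin 4) : divV (sliceA 3) y x z (Sum.inl α) (Sum.inr j) = 0 := by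
  rw [divV_apply]
  exact Finset.sum_eq_zero fun μ _ => by show (0 : ℝ) - 0 = 0; rw [sub_zero]

/-- [our object] idem, multiplier–field block. -/
theorem divV_sliceA_inr_inl (y x z : Site 4) (i β : Fin 4) : divV (sliceA 3) y x z (Sum.inr i) (Sum.inl β) = 0 := by
  rw [divV_apply]
  exact Finset.sum_eq_zero fun μ _ => by show (0 : ℝ) - 0 = 0; rw [sub_zero]

/-- [our object] idem, multiplier block. -/
theorem divV_sliceA_inr_inr (y x z : Site 4) (i j : Fin 4) : divV (sliceA 3) y x z (Sum.inr i) (Sum.inr j) = 0 := by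
  rw [divV_apply]
  exact Finset.sum_eq_zero fun μ _ => by show (0 : ℝ) - 0 = 0; rw [sub_zero]

end Divergence

/-! ## §4 [our object] THE SLICE GAUGE LAW -/

section Law

/-- [our object] THE COMMUTATOR OF A KERNEL WITH THE ROAD's SITE PROJECTION, entrywise:
`(K ∘ Π_y − Π_y ∘ K) x z a b = [z = y]·K x y a b·fmask b − [x = y]·fmask a·K y z a b`. -/
theorem commutator_proj_apply (K : MKer 4 (Fib 3)) (y x z : Site 4) (a b : Fib 3) : (comp K (proj y) - comp (proj y) K) x z a b
    = (if z = y then (1 : ℝ) else 0) * (K x y a b * fmask b) - (if x = y then (1 : ℝ) else 0) * (fmask a * K y z a b) := by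
  rw [Pi.sub_apply, Pi.sub_apply, Pi.sub_apply, Pi.sub_apply, proj_def, comp_projM, projM_comp, boole_mul, boole_mul]

/-- [our object] **THE SLICE GAUGE LAW (a4, slice half, straight reading)**: `divV (sliceA 3) y = 1 • (ddKer ∘ Π_y − Π_y ∘ ddKer)` — the lattice divergence, in the
background bond at `y`, of the antisymmetrised first jet of the `ξ = 1` background-Feynman slice IS the commutator of the slice Hessian `dd*` with the site
projection (infinitesimal background-gauge covariance of `½|D*_B W|²` differentiated once at `B = 𝟙`, colour-stripped), with constant `c_s = 1`. -/
theorem divV_sliceA (y : Site 4) : divV (sliceA 3) y = (1 : ℝ) • (comp ddKer (proj y) - comp (proj y) ddKer) := by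
  rw [one_smul]
  funext x z a b
  rw [commutator_proj_apply]
  rcases a with α | i <;> rcases b with β | j
  · rw [divV_sliceA_inl_inl, ddKer_apply_row x y α β, ddKer_apply y z α β, fmask_inl, fmask_inl]
    ring
  · rw [divV_sliceA_inl_inr, ddKer_inl_inr, ddKer_inl_inr]
    ring
  · rw [divV_sliceA_inr_inl, ddKer_inr_inl, ddKer_inr_inl]
    ring
  · rw [divV_sliceA_inr_inr, ddKer_inr_inr, ddKer_inr_inr]
    ring

end Law

/-! ## §5 [our object] The fibre-transposed reading (= `MF`'s convention) -/

section Transpose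

/-- [our object] **THE SLICE GAUGE LAW IN `MF`'s FIBRE CONVENTION**: the fibre-transposed family `(κ, u, x, z, a, b) ↦ sliceA 3 κ u x z b a` obeys the law with the
SAME constant `1` against the fibre-transposed kernel `(x, z, a, b) ↦ ddKer x z b a` — which IS `MF`'s slice block (`MF_inl_inl_eq_deltaZLim_add_ddKer`). -/
theorem divV_sliceA_fibreTranspose (y : Site 4) :
    divV (fun κ u x z a b => sliceA 3 κ u x z b a) y
      = (1 : ℝ) • (comp (fun x z a b => ddKer x z b a) (proj y) - comp (proj y) (fun x z a b => ddKer x z b a)) := by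
  rw [one_smul]
  funext x z a b
  rw [commutator_proj_apply, divV_apply]
  have h := congrFun (congrFun (congrFun (congrFun (divV_sliceA y) x) z) b) a
  rw [divV_apply, one_smul, commutator_proj_apply] at h
  rw [h]
  rcases a with α | i <;> rcases b with β | j
  · rw [fmask_inl, fmask_inl]
  · rw [ddKer_inr_inl, ddKer_inr_inl]; ring
  · rw [ddKer_inl_inr, ddKer_inl_inr]; ring
  · rw [fmask_inr, fmask_inr]

end Transpose

/-! ## §6 [our object] LOCATED L-gan24leaf02-g41-1: against `MF`'s own slice block the straight family obeys NO commutator law -/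

section NoGo

/-- [folklore] the six unit-vector inequalities the witness entry needs (each read off one coordinate). -/
theorem unitVec_zero_ne : (unitVec (0 : Fin 4) : Site 4) ≠ 0 ∧ (unitVec (0 : Fin 4) : Site 4) ≠ unitVec 1
    ∧ (unitVec (0 : Fin 4) : Site 4) ≠ -unitVec 1 ∧ (unitVec (0 : Fin 4) : Site 4) ≠ unitVec 1 - unitVec 0
    ∧ (unitVec (0 : Fin 4) : Site 4) ≠ -unitVec 0 := by
  refine ⟨?_, ?_, ?_, ?_, ?_⟩ <;> intro h <;> have := congrFun h 0 <;> simp [unitVec] at this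

/-- [folklore] … and the one read off the second coordinate. -/
theorem unitVec_zero_ne' : (unitVec (0 : Fin 4) : Site 4) ≠ unitVec 0 - unitVec 1 := by
  intro h
  have := congrFun h 1
  simp [unitVec] at this

/-- [our object] **LOCATED L-gan24leaf02-g41-1 (kernel form).**  Against the FIBRE-TRANSPOSED slice Hessian `ddKerᶠ x z a b := ddKer x z b a` — i.e. against the slice
block of the road's `MF` AS TYPED — the straight H2V-2 family `sliceA 3` satisfies NO gauge-commutator law: for every constant `c`,
`divV (sliceA 3) 0 ≠ c • (ddKerᶠ ∘ Π_0 − Π_0 ∘ ddKerᶠ)`.  Witness entry `(x, a; z, b) = (0, inl 0; e_0, inl 1)`: left side `1`, right side `c·0`.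
So W2's letter (a4-total) against `MF` is to be fed vertex data in `MF`'s fibre convention (§5), or `MF` re-read straight — the owner's convention decision
(N-d1leaf02g9-1); nothing is chosen here. -/
theorem not_divV_sliceA_against_MF_slice (c : ℝ) :
    divV (sliceA 3) 0 ≠ c • (comp (fun x z a b => ddKer x z b a) (proj 0) - comp (proj 0) (fun x z a b => ddKer x z b a)) := by
  intro h
  obtain ⟨h0, h01, h01n, h010, h00n⟩ := unitVec_zero_ne
  have h001 := unitVec_zero_ne'
  have e := congrFun (congrFun (congrFun (congrFun h 0) (unitVec 0)) (Sum.inl 0)) (Sum.inl 1)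
  rw [Pi.smul_apply, Pi.smul_apply, Pi.smul_apply, Pi.smul_apply, commutator_proj_apply, divV_sliceA_inl_inl,
    ddKer_apply 0 (unitVec 0) 1 0, fmask_inl, smul_eq_mul] at e
  simp only [if_true, zero_sub, zero_add, h0, h01, h01n, h010, h00n, h001, if_false] at e
  norm_num at e

end NoGo

end Summit.QuantumFields.BalabanUV.Beta.FP.SliceGaugeLaw

end
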